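import Summits.CriticalPhenomena.PercolationContinuityZ3.Theorems.PercNearOneGluingNoHeavyLowerTailThreePartitionCubeDict
import Summits.CriticalPhenomena.PercolationContinuityZ3.Theorems.PercNearOneGluingNoHeavyLowerTailThreePartitionCubeSymA
import Mathlib.Data.Finset.Sort

/-!
# Twisted three-partition positivity (★★) = (M⁺-3) on SIX letters: soundness of the checker, XII — **representing a conditioned pair by a
# coloured node**

Support file (cell `prim-sahi`, seat `prim-sahi-typer` gen 34/35; `--supports stmt-CriticalPhenomena-4575`).  Pure, plus the definitions
`sortedCodes`, `colouring`; no `sorry`, standard axioms.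
* `sortedCodes N` — the increasing list of the codes of `N ⊆ 2^[m]`; `colouring N₁ Q` — the checker's colouring word of the class `N₁`;
  `repr_of_pairCond` — a conditioned pair `(A, B)` whose least code (if any) is coloured first is REPRESENTED (`Repr`) by
  `(sortedCodes (coGen A ∪ coGen B), colouring (coGen A) _)`; the node is an increasing antichain of codes (`sortedCodes_pairwise`, `sub_false_of_ne`);
* `classKey_eq_statS` — the class keys are the first-order statistics of the two classes' code sets.
The chunk ⇒ relative-dual-cone lemma built on this (`inDualRel_of_chunkCheck`) is in `…CubeNormal`. [this work]
-/

namespace Summit.CriticalPhenomena.PercolationContinuityZ3.Theorems.ThreePartition.Cube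

open Finset SahiGridPattern.Pair43 SahiC3Cube
open scoped Classical

variable {m : ℕ}

/-! ### The node of a finite family of points -/

/-- The increasing list of the codes of the points of `N`. [this work] -/
noncomputable def sortedCodes (N : Finset (Set (Fin m))) : List ℕ := (N.image encS).sort (· ≤ ·)

/-- `sortedCodes` is duplicate-free. [this work] -/
theorem sortedCodes_nodup (N : Finset (Set (Fin m))) : (sortedCodes N).Nodup := Finset.sort_nodup _ _

/-- `sortedCodes` is strictly increasing. [this work] -/
theorem sortedCodes_pairwise (N : Finset (Set (Fin m))) : (sortedCodes N).Pairwise (· < ·) :=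
  List.sortedLT_iff_pairwise.1 (Finset.sortedLT_sort _)

/-- Membership in `sortedCodes`. [this work] -/
theorem mem_sortedCodes {N : Finset (Set (Fin m))} {x : ℕ} : x ∈ sortedCodes N ↔ ∃ z ∈ N, encS z = x := by
  unfold sortedCodes; rw [Finset.mem_sort, mem_image]

/-- The underlying finset of `sortedCodes`. [this work] -/
theorem sortedCodes_toFinset (N : Finset (Set (Fin m))) : (sortedCodes N).toFinset = N.image encS := by
  unfold sortedCodes; exact Finset.sort_toFinset _ _

/-- The codes are below `2^m`. [this work] -/
theorem sortedCodes_lt (N : Finset (Set (Fin m))) : CodesLt m (sortedCodes N) := by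
  intro x hx; obtain ⟨z, _, rfl⟩ := mem_sortedCodes.1 hx; exact encS_lt z

/-- The length is the number of points. [this work] -/
theorem sortedCodes_length (N : Finset (Set (Fin m))) : (sortedCodes N).length = N.card := by
  unfold sortedCodes
  rw [Finset.length_sort, card_image_of_injective _ (fun a b h => by rw [← pt_encS a, ← pt_encS b]; exact congrArg _ h)]

/-- Positions of `sortedCodes` enumerate `N`. [this work] -/
theorem pt_getD_mem {N : Finset (Set (Fin m))} {j : ℕ} (hj : j < (sortedCodes N).length) : pt m ((sortedCodes N).getD j 0) ∈ N := by
  have hmem : (sortedCodes N).getD j 0 ∈ sortedCodes N := by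
    rw [List.getD_eq_getElem (l := sortedCodes N) (d := 0) hj]; exact List.getElem_mem hj
  obtain ⟨z, hz, hzx⟩ := mem_sortedCodes.1 hmem
  rw [← hzx, pt_encS]; exact hz

/-- Every point of `N` occurs at some position. [this work] -/
theorem exists_getD_eq {N : Finset (Set (Fin m))} {z : Set (Fin m)} (hz : z ∈ N) : ∃ j < (sortedCodes N).length, (sortedCodes N).getD j 0 = encS z := by
  have hmem : encS z ∈ sortedCodes N := mem_sortedCodes.2 ⟨z, hz, rfl⟩
  obtain ⟨j, hj, hjx⟩ := List.mem_iff_getElem.1 hmem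
  exact ⟨j, hj, by rw [List.getD_eq_getElem (l := sortedCodes N) (d := 0) hj]; exact hjx⟩

/-- Distinct positions carry distinct codes. [this work] -/
theorem sortedCodes_inj (N : Finset (Set (Fin m))) {j j' : ℕ} (hj : j < (sortedCodes N).length) (hj' : j' < (sortedCodes N).length)
    (h : (sortedCodes N).getD j 0 = (sortedCodes N).getD j' 0) : j = j' := by
  rw [List.getD_eq_getElem (l := sortedCodes N) (d := 0) hj, List.getD_eq_getElem (l := sortedCodes N) (d := 0) hj'] at h
  exact (List.Nodup.getElem_inj_iff (sortedCodes_nodup N)).1 h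

/-- `PtsLt` for the node. [this work] -/
theorem ptsLt_sortedCodes (N : Finset (Set (Fin m))) : PtsLt m (sortedCodes N).toArray := by
  intro j hj
  rw [List.size_toArray] at hj
  rw [SahiHitting.array_getD_eq]; exact (sortedCodes_lt N).getD_lt hj

/-- In an antichain, distinct codes of the node are incomparable. [this work] -/
theorem sub_false_of_ne {N : Finset (Set (Fin m))} (hN : IsAntichain (· ≤ ·) (N : Set (Set (Fin m)))) :
    ∀ q ∈ sortedCodes N, ∀ q' ∈ sortedCodes N, q ≠ q' → sub q q' = false := by
  intro q hq q' hq' hne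
  obtain ⟨z, hz, rfl⟩ := mem_sortedCodes.1 hq
  obtain ⟨z', hz', rfl⟩ := mem_sortedCodes.1 hq'
  have hzz : z ≠ z' := fun h => hne (by rw [h])
  by_contra hsub
  rw [Bool.not_eq_false, sub_eq_true_iff _ (encS_lt z), pt_encS, pt_encS] at hsub
  exact hN (mem_coe.2 hz) (mem_coe.2 hz') hzz hsub

/-! ### The colouring word -/

/-- The colouring word of the class `N₁`: bit `j-1` says whether the `j`-th point (`j ≥ 1`) lies in `N₁`. [this work] -/
noncomputable def colouring (N₁ : Finset (Set (Fin m))) (Q : List ℕ) : ℕ :=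
  maskOfN (Q.length - 1) fun j => decide (pt m (Q.getD (j + 1) 0) ∈ N₁)

/-- The colouring word is below `2^(n-1)`. [this work] -/
theorem colouring_lt (N₁ : Finset (Set (Fin m))) (Q : List ℕ) : colouring N₁ Q < 1 <<< (Q.length - 1) := by
  rw [Nat.one_shiftLeft]; exact maskOfN_lt _ _

/-- `inFirst` of the colouring word reads class membership (the least point being in the class). [this work] -/
theorem inFirst_colouring_iff {N₁ : Finset (Set (Fin m))} {Q : List ℕ} (h0 : pt m (Q.getD 0 0) ∈ N₁) {j : ℕ} (hj : j < Q.length) :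
    inFirst (colouring N₁ Q) j = true ↔ pt m (Q.getD j 0) ∈ N₁ := by
  unfold inFirst colouring
  rcases Nat.eq_zero_or_pos j with rfl | hpos
  · exact ⟨fun _ => h0, fun _ => by simp⟩
  · rw [Bool.or_eq_true, decide_eq_true_iff, testBit_maskOfN, Bool.and_eq_true, decide_eq_true_iff, decide_eq_true_iff,
      Nat.sub_add_cancel hpos]
    constructor
    · rintro (h | ⟨_, h⟩)
      · omega
      · exact h
    · intro h; exact Or.inr ⟨by omega, h⟩

/-! ### Representing a conditioned pair -/

/-- **A conditioned pair is represented by its node and colouring word** (when its least code, if any, is coloured first). [this work] -/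
theorem repr_of_pairCond {A B : Finset (Set (Fin m))} (hAB : PairSat.PairCond A B)
    (h0 : sortedCodes (PairSat.coGen A ∪ PairSat.coGen B) ≠ [] →
      pt m ((sortedCodes (PairSat.coGen A ∪ PairSat.coGen B)).getD 0 0) ∈ PairSat.coGen A) :
    Repr m A B (sortedCodes (PairSat.coGen A ∪ PairSat.coGen B)).toArray
      (colouring (PairSat.coGen A) (sortedCodes (PairSat.coGen A ∪ PairSat.coGen B))) := by
  set N := PairSat.coGen A ∪ PairSat.coGen B with hN
  set Q := sortedCodes N with hQ
  have hfirst : ∀ {j}, j < Q.length → (inFirst (colouring (PairSat.coGen A) Q) j = true ↔ pt m (Q.getD j 0) ∈ PairSat.coGen A) := by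
    intro j hj
    have hne : Q ≠ [] := List.ne_nil_of_length_pos (by omega)
    exact inFirst_colouring_iff (h0 hne) hj
  refine ⟨ptsLt_sortedCodes N, fun a => ?_, fun b => ?_⟩
  · simp only [List.size_toArray, SahiHitting.array_getD_eq]
    constructor
    · intro ha
      obtain ⟨j, hj, hjx⟩ := exists_getD_eq (N := N) (mem_union_left _ ha)
      refine ⟨j, hj, (hfirst hj).2 (by rw [hjx, pt_encS]; exact ha), by rw [hjx, pt_encS]⟩
    · rintro ⟨j, hj, hf, rfl⟩
      exact (hfirst hj).1 hf
  · simp only [List.size_toArray, SahiHitting.array_getD_eq]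
    have hdisj := hAB.disjoint_coGen
    constructor
    · intro hb
      obtain ⟨j, hj, hjx⟩ := exists_getD_eq (N := N) (mem_union_right _ hb)
      refine ⟨j, hj, ?_, by rw [hjx, pt_encS]⟩
      cases hf : inFirst (colouring (PairSat.coGen A) Q) j
      · rfl
      · have ha := (hfirst hj).1 hf
        rw [hjx, pt_encS] at ha
        exact absurd hb (Finset.disjoint_left.1 hdisj ha)
    · rintro ⟨j, hj, hf, rfl⟩
      have hmem := pt_getD_mem (N := N) hj
      rcases mem_union.1 hmem with ha | hb
      · have := (hfirst hj).2 ha; rw [hf] at this; exact absurd this Bool.false_ne_true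
      · exact hb

/-- **The class keys are the first-order statistics of the classes' code sets.** [this work] -/
theorem classKey_eq_statS {A B : Finset (Set (Fin m))} {Q : List ℕ} {mm : ℕ} (hR : Repr m A B Q.toArray mm) (hQ : CodesLt m Q)
    (hnd : Q.Nodup) (i : ℕ) :
    classKey (mkTabs m) Q.toArray mm true i = statS m ((PairSat.coGen A).image encS) i ∧
      classKey (mkTabs m) Q.toArray mm false i = statS m ((PairSat.coGen B).image encS) i := by
  have hlt : ∀ j < Q.length, Q.getD j 0 < 2 ^ m := fun j hj => hQ.getD_lt hj
  have hc1 := hR.cls1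
  have hc2 := hR.cls2
  simp only [List.size_toArray, SahiHitting.array_getD_eq] at hc1 hc2
  have hinjQ : Set.InjOn (fun j => Q.getD j 0) ↑(range Q.length) := by
    intro j hj j' hj' h
    rw [coe_range, Set.mem_Iio] at hj hj'
    dsimp only at h
    rw [List.getD_eq_getElem (l := Q) (d := 0) hj, List.getD_eq_getElem (l := Q) (d := 0) hj'] at h
    exact (List.Nodup.getElem_inj_iff hnd).1 h
  have key : ∀ (b : Bool) (C : Finset (Set (Fin m))), (∀ c, c ∈ C ↔ ∃ j < Q.length, inFirst mm j = b ∧ pt m (Q.getD j 0) = c) →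
      classKey (mkTabs m) Q.toArray mm b i = statS m (C.image encS) i := by
    intro b C hC
    rw [classKey_eq hQ, statS, ← sum_filter]
    have hset : C.image encS = ((range Q.length).filter fun j => (inFirst mm j == b) = true).image fun j => Q.getD j 0 := by
      ext x
      simp only [mem_image, mem_filter, mem_range, beq_iff_eq]
      constructor
      · rintro ⟨c, hc, rfl⟩
        obtain ⟨j, hj, hf, hjc⟩ := (hC c).1 hc
        exact ⟨j, ⟨hj, hf⟩, by rw [← hjc, encS_pt (hlt j hj)]⟩
      · rintro ⟨j, ⟨hj, hf⟩, rfl⟩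
        exact ⟨pt m (Q.getD j 0), (hC _).2 ⟨j, hj, hf, rfl⟩, encS_pt (hlt j hj)⟩
    rw [hset, sum_image (hinjQ.mono (fun j hj => (mem_filter.1 hj).1))]
  exact ⟨key true _ hc1, key false _ hc2⟩

end Summit.CriticalPhenomena.PercolationContinuityZ3.Theorems.ThreePartition.Cube
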